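import Literature.NumberTheory.EllipticCurves.LangHeightLemma3Counting
import Literature.NumberTheory.EllipticCurves.LangHeightLemma3LocalProofs
import Literature.NumberTheory.EllipticCurves.NeronLocalHeightPotentialGoodReduction
import Literature.NumberTheory.EllipticCurves.NeronLocalHeightPotentialMultiplicative
import Literature.NumberTheory.EllipticCurves.LangHeightKodairaNeronProofs
import HarnessLib

/-!
# Petsche 2006, Proposition 7 and Lemma 3 over `ℚ`: the discharges

Topic `NumberTheory/EllipticCurves` (family `abc`, G06). Sibling proof file of
`LangHeightSzpiroRatio.lean`. It **discharges** the named facts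

* `Literature.NumberTheory.EllipticCurves.Petsche2006_lemma3` (`LangHeightNonarchEstimate.lean`;
  C. Petsche, *Small rational points on elliptic curves over number fields*, New York J. Math. 12
  (2006), Lemma 3) — `Petsche2006_lemma3_holds`;
* `Literature.NumberTheory.EllipticCurves.Petsche2006_card_smallPoints_le` (`LangHeightSzpiroRatio.lean`;
  Petsche 2006, Proposition 7 over `ℚ`) — `Petsche2006_card_smallPoints_le_holds`;

and records the consequences already assembled in the tree conditionally on Lemma 3
(`LangHeightKodairaNeronProofs.lean`): `Petsche2006_le_finsum_localHeightDiscSum_holds`,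
`Petsche2006_langHeightLowerBound_holds` (Petsche 2006, Thm. 2 over `ℚ`) and
`szpiro_imp_langHeightLowerBoundConjecture_holds` (Hindry–Silverman 1988, Thm. 0.3 over `ℚ`:
Szpiro's conjecture implies Lang's height lower bound conjecture).

## Proof of Lemma 3

`Petsche2006_lemma3_of_localStructure` (`LangHeightLemma3Counting.lean`, Petsche's counting and
Fourier argument) reduces Lemma 3 at `(W, v)` to a subgroup `H ≤ E(ℚ)` of index dividing `c_v`,
a real `0 ≤ J ≤ L = ord_v(Δ_min) log p_v` and a homomorphism `r : E(ℚ) → ℝ/ℤ` vanishing on `H`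
with `λ_v ≥ L/12` on `H ∖ {O}` and `λ_v(P) ≥ ½ 𝐁₂(r(P)) J` for `P ≠ O`. We take
`H = T⁻¹(E₀(ℚ_v))` for the transport `T : E(ℚ) → E_min(ℚ_v)` to the local minimal model
(`exists_transport_localMinimalModel`, `LangHeightLemma3LocalProofs.lean`: injective, `λ`-preserving,
ATAEC VI.4.1 on `E₀`), so `[E(ℚ) : H] ∣ [E_min(ℚ_v) : E₀(ℚ_v)] = c_v`; and

* if `|j|_v ≤ 1`: `J = 0`, `r = 0`, and `λ_v ≥ 0` by
  `neronLocalHeight_padicAbv_nonneg_of_padicAbv_j_le_one` (`NeronLocalHeightPotentialGoodReduction.lean`,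
  potential good reduction);
* if `|j|_v > 1`: `J = log|j|_v ≤ L` (`j Δ_min = c₄³` with `c₄` integral) and `r` from
  `exists_addMonoidHom_bernoulli_of_one_lt_padicAbv_j` (`NeronLocalHeightPotentialMultiplicative.lean`,
  the `B₂`-structure at potentially multiplicative places); `r` vanishes on `H` because off its
  kernel `λ_v(P) = ½ 𝐁₂(r(P)) J < J/12 ≤ L/12 ≤ λ_v(P)` (`𝐁₂ < 1/6` off `0`).

## References

* C. Petsche, *Small rational points on elliptic curves over number fields*, New York J. Math. 12
  (2006), 257–268 (arXiv math/0508160): Lemma 3, Proposition 7, Theorem 2.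
* M. Hindry, J. H. Silverman, *The canonical height and integral points on elliptic curves*,
  Invent. Math. 93 (1988), 419–450, Thm. 0.3.
* J. H. Silverman, *Advanced Topics in the Arithmetic of Elliptic Curves*, GTM 151 (1994), VI.1–VI.4.
-/

noncomputable section

open scoped Classical

namespace Literature.NumberTheory.EllipticCurves

open IsDedekindDomain Rat.HeightOneSpectrum _root_.WeierstrassCurve _root_.WeierstrassCurve.Affine.Point

/-- `𝐁₂(x) < 1/6 = 𝐁₂(0)` for `x ≠ 0` in `ℝ/ℤ` (`t² − t < 0` on `(0, 1)`). [folklore] -/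
theorem periodizedBernoulli_two_lt_of_ne_zero {x : UnitAddCircle} (hx : x ≠ 0) :
    periodizedBernoulli 2 x < 1 / 6 := by
  obtain ⟨⟨t, ht⟩, rfl⟩ : ∃ y : Set.Ico (0 : ℝ) (0 + 1), ((y : ℝ) : UnitAddCircle) = x :=
    ⟨AddCircle.equivIco 1 0 x, AddCircle.coe_equivIco⟩
  simp only [zero_add] at ht
  have ht0 : t ≠ 0 := by
    rintro rfl
    exact hx (by simp)
  have hpos : 0 < t := lt_of_le_of_ne ht.1 (Ne.symm ht0)
  change periodizedBernoulli 2 ((t : ℝ) : UnitAddCircle) < 1 / 6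
  rw [periodizedBernoulli_two_coe ht.1 ht.2]
  nlinarith [ht.2]

/-- **`log|j|_v ≤ ord_v(Δ_min) log p_v`** when `|j|_v > 1`: on the local minimal model over
`O_v`, `j · Δ = c₄³` with `c₄` integral, so `|j|_v |Δ_min|_v ≤ 1` (Silverman AEC VII.1; Petsche's
`log⁺|j_E|_v ≤ log|1/Δ_v|_v`, display (20)). [cite: Petsche2006, proof of Lemma 3, (20)] -/
theorem log_padicAbv_j_le_ordMinimalDiscriminant (W : WeierstrassCurve ℚ) [W.IsElliptic]
    (v : HeightOneSpectrum ℤ) (hj : 1 < padicAbv v W.j) :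
    Real.log (padicAbv v W.j) ≤ (W.ordMinimalDiscriminant v : ℝ) * Real.log (natGenerator v) := by
  haveI := W.isElliptic_localMinimalModel v
  set Kv := v.adicCompletion ℚ
  set E := W.localMinimalModel v with hE
  -- `j(E) = j(W)` in `ℚ_v`
  have hjE : E.j = algebraMap ℚ Kv W.j := by
    have hC : (((W.baseChange Kv).exists_isMinimal (v.adicCompletionIntegers ℚ)).choose •
        W.baseChange Kv).j = algebraMap ℚ Kv W.j := by
      rw [variableChange_j]; exact W.map_j _
    exact hC
  -- `‖c₄(E)‖ ≤ 1`
  have hc4 : ‖E.c₄‖ ≤ 1 := by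
    rw [← WeierstrassCurve.integralModel_c₄_eq (v.adicCompletionIntegers ℚ) E]
    exact Valued.toNormedField.norm_le_one_iff.mpr
      ((HeightOneSpectrum.mem_adicCompletionIntegers ℤ ℚ v).mp (Subtype.mem _))
  have key : algebraMap ℚ Kv W.j * E.Δ = E.c₄ ^ 3 := by
    rw [← hjE, WeierstrassCurve.j, ← WeierstrassCurve.coe_Δ', mul_comm, ← mul_assoc,
      Units.mul_inv, one_mul]
  have hnorm : ‖algebraMap ℚ Kv W.j‖ * ‖E.Δ‖ ≤ 1 := by
    rw [← norm_mul, key, norm_pow]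
    exact pow_le_one₀ (norm_nonneg _) hc4
  have hjv : ‖algebraMap ℚ Kv W.j‖ = padicAbv v W.j := toAbsoluteValue_adicCompletion_algebraMap v W.j
  have hΔ := log_norm_Δ_localMinimalModel v W
  have hΔpos : 0 < ‖E.Δ‖ := norm_pos_iff.mpr E.isUnit_Δ.ne_zero
  have hjpos : 0 < ‖algebraMap ℚ Kv W.j‖ := by rw [hjv]; exact zero_lt_one.trans hj
  have hlog : Real.log ‖algebraMap ℚ Kv W.j‖ + Real.log ‖E.Δ‖ ≤ 0 := by
    rw [← Real.log_mul hjpos.ne' hΔpos.ne']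
    exact Real.log_nonpos (by positivity) hnorm
  rw [hjv, hΔ] at hlog
  linarith

/-- **Discharge of `Petsche2006_lemma3`** (Petsche 2006, Lemma 3, over `ℚ` at every finite place,
for rational points): see the module docstring. [cite: Petsche2006, Lemma 3] -/
theorem Petsche2006_lemma3_holds : Petsche2006_lemma3 := by
  refine Petsche2006_lemma3_of_localStructure fun W _ v => ?_
  obtain ⟨T, hTinj, hTlam, hT0⟩ := exists_transport_localMinimalModel W v
  set E₀ := (W.localMinimalModel v).goodReductionSubgroup (v.adicCompletionIntegers ℚ) with hE₀
  set H : AddSubgroup W.toAffine.Point := E₀.comap T with hH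
  have hHc : H.index ∣ W.tamagawaNumberAt v := by
    rw [hH, AddSubgroup.index_comap]
    exact E₀.relIndex_dvd_index_of_normal _
  have hH0 : ∀ P ∈ H, P ≠ 0 →
      1 / 12 * ((W.ordMinimalDiscriminant v : ℝ) * Real.log (natGenerator v)) ≤
        P.neronLocalHeight (padicAbv v) := fun P hP hP0 => hT0 P hP0 hP
  set L : ℝ := (W.ordMinimalDiscriminant v : ℝ) * Real.log (natGenerator v) with hL
  have hL0 : 0 ≤ L :=
    mul_nonneg (Nat.cast_nonneg _) (Real.log_nonneg (by exact_mod_cast (prime_natGenerator v).one_lt.le))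
  by_cases hj : padicAbv v W.j ≤ 1
  · -- potential good reduction: `J = 0`, `r = 0`
    refine ⟨H, 0, 0, hHc, le_rfl, hL0, hH0, fun P _ => rfl, fun P hP => ?_⟩
    rw [mul_zero]
    exact neronLocalHeight_padicAbv_nonneg_of_padicAbv_j_le_one W v hj P hP
  · -- potentially multiplicative reduction: `J = log |j|_v`
    push Not at hj
    obtain ⟨r, hrle, hreq⟩ := exists_addMonoidHom_bernoulli_of_one_lt_padicAbv_j W v hj
    have hJ0 : 0 ≤ Real.log (padicAbv v W.j) := Real.log_nonneg hj.le
    have hJL : Real.log (padicAbv v W.j) ≤ L := log_padicAbv_j_le_ordMinimalDiscriminant W v hj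
    refine ⟨H, r, Real.log (padicAbv v W.j), hHc, hJ0, hJL, hH0, fun P hP => ?_, hrle⟩
    by_contra hr
    have hP0 : P ≠ 0 := by
      rintro rfl
      exact hr (map_zero r)
    have h1 := hreq P hr
    have h2 := hH0 P hP hP0
    have hB := periodizedBernoulli_two_lt_of_ne_zero hr
    have h3 : 1 / 2 * periodizedBernoulli 2 (r P) * Real.log (padicAbv v W.j) ≤
        1 / 2 * (1 / 6) * Real.log (padicAbv v W.j) :=
      mul_le_mul_of_nonneg_right (by linarith) hJ0
    -- `λ = ½𝐁₂(rP) J ≤ J/12 ≤ L/12 ≤ λ` with `𝐁₂(rP) < 1/6`: contradiction unless `J = 0`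
    have hJpos : 0 < Real.log (padicAbv v W.j) := Real.log_pos hj
    have : 1 / 2 * periodizedBernoulli 2 (r P) * Real.log (padicAbv v W.j) <
        1 / 2 * (1 / 6) * Real.log (padicAbv v W.j) :=
      mul_lt_mul_of_pos_right (by linarith) hJpos
    linarith

/-- **Discharge of `Petsche2006_card_smallPoints_le`** (Petsche 2006, Proposition 7 over `ℚ`:
the number of rational points with `ĥ ≤ log N(𝔇)/(2¹³·3·σ²)` is at most `c₁ σ² log(c₂ σ²)`),
from Lemma 3 through the tree's assembly `Petsche2006_card_smallPoints_le_of_lemma3`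
(`LangHeightKodairaNeronProofs.lean`). [cite: Petsche2006, Prop. 7] -/
theorem Petsche2006_card_smallPoints_le_holds : Petsche2006_card_smallPoints_le :=
  Petsche2006_card_smallPoints_le_of_lemma3 Petsche2006_lemma3_holds

/-- **Discharge of `Petsche2006_le_finsum_localHeightDiscSum`** (Petsche 2006, proof of Prop. 7,
the non-archimedean estimate over `ℚ`). [cite: Petsche2006, proof of Prop. 7] -/
theorem Petsche2006_le_finsum_localHeightDiscSum_holds : Petsche2006_le_finsum_localHeightDiscSum :=
  Petsche2006_le_finsum_localHeightDiscSum_of_lemma3 Petsche2006_lemma3_holds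

/-- **Discharge of `Petsche2006_langHeightLowerBound`** (Petsche 2006, Theorem 2 over `ℚ`:
`ĥ(P) ≥ c(1, σ) log N(𝔇)` for non-torsion `P`). [cite: Petsche2006, Thm. 2] -/
theorem Petsche2006_langHeightLowerBound_holds : Petsche2006_langHeightLowerBound :=
  Petsche2006_langHeightLowerBound_of_lemma3 Petsche2006_lemma3_holds

/-- **Discharge of `szpiro_imp_langHeightLowerBoundConjecture`** (Hindry–Silverman 1988,
Thm. 0.3 over `ℚ`: Szpiro's conjecture implies Lang's height lower bound conjecture), through
Petsche's Theorem 2. [cite: HindrySilverman1988, Thm 0.3] -/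
theorem szpiro_imp_langHeightLowerBoundConjecture_holds : szpiro_imp_langHeightLowerBoundConjecture :=
  szpiro_imp_langHeightLowerBoundConjecture_of_lemma3 Petsche2006_lemma3_holds

end Literature.NumberTheory.EllipticCurves

end
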